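import Literature.AlgebraicGeometry.HodgeTheory.AbelianVarietyEndomorphismStableSubvarieties
import Literature.AlgebraicGeometry.HodgeTheory.AbelianVarietySubvarietyIsotypicPieces
import Literature.AlgebraicGeometry.Motives.AbelianVarietyQuasiIdempotentImageOrder
import HarnessLib

/-!
# An isogeny identifies the lattices of abelian subvarieties, and of `End`-stable abelian subvarieties, of its source and target
# (over any field): `Z ↦ f(Z)`, `Z' ↦ g(Z')` for a quasi-inverse `f g = g f = N`
# (Mumford §19 Thm. 1 and Remark p. 169; Silverberg–Zarhin 2015 Def. 2.2–2.3; Zarhin 2008 Thm. 3.2)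

Layer `Literature/AlgebraicGeometry/HodgeTheory`; theorems only (no `def`, no instance, no named fact; net debt 0); every statement
over an ARBITRARY field.  The tree's `…EndAlgebraReducedIffEndReduced.natCard_setOf_range_subvariety_eq_of_isIsogenous` and
`…StableSubvarietiesLattice.nonempty_orderIso_stable_of_isIsogenous` compare the lattices of isogenous abelian varieties over a
PERFECT field by COUNTING (`2^r` on both sides).  Here the explicit, field-independent comparison: for homomorphisms `f : X → X'`,
`g : X' → X` with `f ≫ g = N • 𝟙`, `g ≫ f = N • 𝟙`, `N ≥ 1` (any isogeny and a quasi-inverse), the direct image `Z ↦ f(Z)` of closed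
subsets sends abelian subvarieties to abelian subvarieties, `End X`-stable ones to `End X'`-stable ones (`ψ(f(Z)) = N⁻¹ f((f ψ g)(Z))
⊆ f(Z)` on the level of abelian subvarieties, `[N]` being surjective on them), and `g(f(Z)) = [N] Z = Z`; hence `Z ↦ f(Z)` is an
ORDER ISOMORPHISM (for inclusion) between the abelian subvarieties of `X` and of `X'`, restricting to an order isomorphism between the
`End`-stable ones, with inverse `Z' ↦ g(Z')`.  In particular isogenous abelian varieties have order-isomorphic lattices of abelian subvarieties, and simultaneously finite
lattices of `End`-stable abelian subvarieties, over any field.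

THE PRINT.  Mumford, *Abelian Varieties* §19 Thm. 1 (p. 173) and Remark p. 169 (isogeny is an equivalence relation: `f g = n_X`);
Silverberg–Zarhin 2015 Def. 2.2–2.3 (p. 3); Zarhin 2008 Thm. 3.2 and §5 (pp. 7, 9); Görtz–Wedhorn I Remark 10.32 (images of closed
subsets under morphisms).

Results (namespace `Literature.AlgebraicGeometry.HodgeTheory.AbelianVariety`; `hfg : f ≫ g = N • 𝟙 X`, `hgf : g ≫ f = N • 𝟙 X'`):
* §1 `range_toSchemeHom_nsmul_of_ne_zero`, `image_range_eq_range_comp`, `exists_subvariety_image_range` (`f(Z)` is an abelian subvariety), **`image_image_range_eq`**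
  (`g(f(Z)) = Z`), **`image_range_subset_image_range_iff`** (`f(Z₁) ⊆ f(Z₂)` iff `Z₁ ⊆ Z₂`),
  **`forall_range_comp_subset_of_comp_eq_nsmul`** (`f(Z)` is `End X'`-stable when `Z` is `End X`-stable),
  `forall_range_comp_subset_iff_of_comp_eq_nsmul`;
* §2 **`exists_orderIso_subvarieties_of_comp_eq_nsmul`** (`Z ↦ f(Z)` : {abelian subvarieties of X} ≃o {… of X'}),
  **`exists_orderIso_stable_subvarieties_of_comp_eq_nsmul`** (restricted to the `End`-stable ones);
* §3 (`X ∼ X'`, any field) **`nonempty_orderIso_subvarieties_of_isIsogenous`**, `finite_setOf_range_stable_subvariety_iff_of_isIsogenous`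
  (the `Nat.card` equalities and the order isomorphism of the stable lattices for `X ∼ X'` follow from §2 by `Nat.card_congr`; the
  tree states them over a perfect field: `…EndAlgebraReducedIffEndReduced.natCard_setOf_range_subvariety_eq_of_isIsogenous`,
  `…StableSubvarietiesLattice.nonempty_orderIso_stable_of_isIsogenous`, `….natCard_setOf_range_stable_subvariety_eq_of_isIsogenous`).

## References
* [MumfordAV1970] D. Mumford, *Abelian Varieties* (1970), §19 Thm. 1 (p. 173) and Remark p. 169.
* [SilverbergZarhin2015] A. Silverberg, Yu. G. Zarhin, *Isogenies of abelian varieties over finite fields* (2015)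
  (arXiv:1409.0592), Def. 2.2–2.3 (p. 3).
* [Zarhin2008HomomorphismsFiniteFields] Yu. G. Zarhin, *Homomorphisms of abelian varieties over finite fields* (2008)
  (arXiv:0711.1615), Thm. 3.2 and §5 (pp. 7, 9).
* [GortzWedhorn2020] U. Görtz, T. Wedhorn, *Algebraic Geometry I*, 2nd ed. (2020), Remark 10.32 (PDF p. 312).
-/

noncomputable section

universe u

open CategoryTheory CategoryTheory.Limits

namespace Literature.AlgebraicGeometry.HodgeTheory

namespace AbelianVariety

open _root_.AlgebraicGeometry
open Literature.AlgebraicGeometry.Motives Literature.AlgebraicGeometry.Motives.AbelianVariety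

variable {K : Type u} [Field K]

/-! ## §1 Direct images of abelian subvarieties under `f` with `f g = g f = N` -/

section Image

variable {X X' Z Z₁ Z₂ : Motives.AbelianVariety K} (f : X ⟶ X') {g : X' ⟶ X} {N : ℕ}

/-- `range (d • φ) = range φ` for `d ≠ 0` and any homomorphism `φ : W → X` (`[d]_W` is surjective; the tree's
`range_toSchemeHom_nsmul` is the case of an endomorphism). [cite: MumfordAV1970, §6 Application 3 (Prop. p. 64) and §19 Thm. 1 (p. 173)] -/
theorem range_toSchemeHom_nsmul_of_ne_zero {W : Motives.AbelianVariety K} {d : ℕ} (hd : d ≠ 0) (φ : W ⟶ X) :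
    Set.range (Hom.toSchemeHom (d • φ)) = Set.range (Hom.toSchemeHom φ) := by
  haveI : Surjective (Hom.toSchemeHom (d • 𝟙 W)) := (isIsogeny_nsmul_id_of_ne_zero W hd).1
  rw [show d • φ = (d • 𝟙 W) ≫ φ by rw [Preadditive.nsmul_comp, Category.id_comp], range_toSchemeHom_comp_eq_of_surjective]

/-- `f(Z) = (Z ↪ X → X')(Z)` as closed subsets. [cite: GortzWedhorn2020, Remark 10.32 (PDF p. 312)] -/
theorem image_range_eq_range_comp (j : Z ⟶ X) :
    Hom.toSchemeHom f '' Set.range (Hom.toSchemeHom j) = Set.range (Hom.toSchemeHom (j ≫ f)) :=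
  (range_toSchemeHom_comp_eq_image j f).symm

/-- **The direct image `f(Z)` of an abelian subvariety is an abelian subvariety** (the image of `Z ↪ X → X'`).
[cite: MumfordAV1970, §19 Thm. 1 (p. 173)] [cite: GortzWedhorn2020, Remark 10.32 (PDF p. 312)] -/
theorem exists_subvariety_image_range (j : Z ⟶ X) :
    ∃ (Z' : Motives.AbelianVariety K) (j' : Z' ⟶ X'), IsClosedImmersion (Hom.toSchemeHom j') ∧
      Hom.toSchemeHom f '' Set.range (Hom.toSchemeHom j) = Set.range (Hom.toSchemeHom j') :=
  ⟨_, imageι (j ≫ f), inferInstance, by rw [image_range_eq_range_comp, range_toSchemeHom_imageι]⟩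

/-- **`g(f(Z)) = Z`** when `f ≫ g = N • 𝟙`, `N ≠ 0` (`g(f(Z)) = [N] Z = Z`). [cite: MumfordAV1970, §19 Remark p. 169 and Thm. 1 (p. 173)] -/
theorem image_image_range_eq (hfg : f ≫ g = N • 𝟙 X) (hN : N ≠ 0) (j : Z ⟶ X) :
    Hom.toSchemeHom g '' (Hom.toSchemeHom f '' Set.range (Hom.toSchemeHom j)) = Set.range (Hom.toSchemeHom j) := by
  rw [image_range_eq_range_comp, image_range_eq_range_comp, Category.assoc, hfg, Preadditive.comp_nsmul, Category.comp_id,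
    range_toSchemeHom_nsmul_of_ne_zero hN]

/-- **`f(Z₁) ⊆ f(Z₂)` iff `Z₁ ⊆ Z₂`** (`f ≫ g = N • 𝟙`, `N ≠ 0`). [cite: MumfordAV1970, §19 Thm. 1 (p. 173)] -/
theorem image_range_subset_image_range_iff (hfg : f ≫ g = N • 𝟙 X) (hN : N ≠ 0) (j₁ : Z₁ ⟶ X) (j₂ : Z₂ ⟶ X) :
    Hom.toSchemeHom f '' Set.range (Hom.toSchemeHom j₁) ⊆ Hom.toSchemeHom f '' Set.range (Hom.toSchemeHom j₂) ↔
      Set.range (Hom.toSchemeHom j₁) ⊆ Set.range (Hom.toSchemeHom j₂) := by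
  refine ⟨fun h ↦ ?_, fun h ↦ Set.image_mono h⟩
  rw [← image_image_range_eq f hfg hN j₁, ← image_image_range_eq f hfg hN j₂]
  exact Set.image_mono h

/-- **`f(Z)` IS `End X'`-STABLE WHEN `Z` IS `End X`-STABLE** (`f ≫ g = N • 𝟙`, `g ≫ f = N • 𝟙`, `N ≠ 0`): for `ψ ∈ End X'`,
`N · ψ(f(Z)) = f((f ψ g)(Z)) ⊆ f(Z)` and `[N]` is surjective on abelian subvarieties.
[cite: SilverbergZarhin2015, Def. 2.2–2.3 (p. 3)] [cite: MumfordAV1970, §19 Remark p. 169 and Thm. 1 (p. 173)] -/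
theorem forall_range_comp_subset_of_comp_eq_nsmul (hgf : g ≫ f = N • 𝟙 X') (hN : N ≠ 0) (j : Z ⟶ X)
    (hstab : ∀ φ : X ⟶ X, Set.range (Hom.toSchemeHom (j ≫ φ)) ⊆ Set.range (Hom.toSchemeHom j)) (ψ : X' ⟶ X') :
    Set.range (Hom.toSchemeHom ((j ≫ f) ≫ ψ)) ⊆ Set.range (Hom.toSchemeHom (j ≫ f)) := by
  have h := Set.image_mono (f := Hom.toSchemeHom f) (hstab (f ≫ ψ ≫ g))
  rw [image_range_eq_range_comp, image_range_eq_range_comp, Category.assoc, Category.assoc, Category.assoc, hgf,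
    Preadditive.comp_nsmul, Category.comp_id, Preadditive.comp_nsmul, Preadditive.comp_nsmul, range_toSchemeHom_nsmul_of_ne_zero hN] at h
  rwa [Category.assoc]

/-- `Z` is `End X`-stable iff `f(Z)` is `End X'`-stable (`f ≫ g = N • 𝟙`, `g ≫ f = N • 𝟙`, `N ≠ 0`).
[cite: SilverbergZarhin2015, Def. 2.2–2.3 (p. 3)] [cite: MumfordAV1970, §19 Remark p. 169] -/
theorem forall_range_comp_subset_iff_of_comp_eq_nsmul (hfg : f ≫ g = N • 𝟙 X) (hgf : g ≫ f = N • 𝟙 X') (hN : N ≠ 0)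
    (j : Z ⟶ X) :
    (∀ φ : X ⟶ X, Set.range (Hom.toSchemeHom (j ≫ φ)) ⊆ Set.range (Hom.toSchemeHom j)) ↔
      ∀ ψ : X' ⟶ X', Set.range (Hom.toSchemeHom ((j ≫ f) ≫ ψ)) ⊆ Set.range (Hom.toSchemeHom (j ≫ f)) := by
  refine ⟨fun h ↦ forall_range_comp_subset_of_comp_eq_nsmul f hgf hN j h, fun h φ ↦ ?_⟩
  have h' := forall_range_comp_subset_of_comp_eq_nsmul g hfg hN (j ≫ f) h φ
  rw [Category.assoc j f g, hfg, Preadditive.comp_nsmul, Category.comp_id, Preadditive.nsmul_comp,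
    range_toSchemeHom_nsmul_of_ne_zero hN, range_toSchemeHom_nsmul_of_ne_zero hN] at h'
  exact h'

end Image

/-! ## §2 The order isomorphisms `Z ↦ f(Z)` -/

section OrderIso

variable {X X' : Motives.AbelianVariety K} (f : X ⟶ X') {g : X' ⟶ X} {N : ℕ}

/-- **`Z ↦ f(Z)` IS AN ORDER ISOMORPHISM BETWEEN THE ABELIAN SUBVARIETIES OF `X` AND OF `X'`** (closed subsets under inclusion;
`f ≫ g = N • 𝟙`, `g ≫ f = N • 𝟙`, `N ≠ 0`), with inverse `Z' ↦ g(Z')`. [cite: MumfordAV1970, §19 Thm. 1 (p. 173) and Remark p. 169]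
[cite: Zarhin2008HomomorphismsFiniteFields, Thm. 3.2 (p. 7)] -/
theorem exists_orderIso_subvarieties_of_comp_eq_nsmul (hfg : f ≫ g = N • 𝟙 X) (hgf : g ≫ f = N • 𝟙 X') (hN : N ≠ 0) :
    ∃ Φ : {R : Set X.X.left | ∃ (Z : Motives.AbelianVariety K) (j : Z ⟶ X),
          IsClosedImmersion (Hom.toSchemeHom j) ∧ R = Set.range (Hom.toSchemeHom j)} ≃o
        {R : Set X'.X.left | ∃ (Z : Motives.AbelianVariety K) (j : Z ⟶ X'),
          IsClosedImmersion (Hom.toSchemeHom j) ∧ R = Set.range (Hom.toSchemeHom j)},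
      ∀ R : {R : Set X.X.left | ∃ (Z : Motives.AbelianVariety K) (j : Z ⟶ X),
          IsClosedImmersion (Hom.toSchemeHom j) ∧ R = Set.range (Hom.toSchemeHom j)},
        ((Φ R : {R : Set X'.X.left | ∃ (Z : Motives.AbelianVariety K) (j : Z ⟶ X'),
          IsClosedImmersion (Hom.toSchemeHom j) ∧ R = Set.range (Hom.toSchemeHom j)}) : Set X'.X.left) =
          Hom.toSchemeHom f '' (R : Set X.X.left) := by
  have memf : ∀ R : Set X.X.left, (∃ (Z : Motives.AbelianVariety K) (j : Z ⟶ X),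
      IsClosedImmersion (Hom.toSchemeHom j) ∧ R = Set.range (Hom.toSchemeHom j)) →
      ∃ (Z : Motives.AbelianVariety K) (j : Z ⟶ X'), IsClosedImmersion (Hom.toSchemeHom j) ∧
        Hom.toSchemeHom f '' R = Set.range (Hom.toSchemeHom j) := by
    rintro R ⟨Z, j, hj, rfl⟩
    exact exists_subvariety_image_range f j
  have memg : ∀ R : Set X'.X.left, (∃ (Z : Motives.AbelianVariety K) (j : Z ⟶ X'),
      IsClosedImmersion (Hom.toSchemeHom j) ∧ R = Set.range (Hom.toSchemeHom j)) →
      ∃ (Z : Motives.AbelianVariety K) (j : Z ⟶ X), IsClosedImmersion (Hom.toSchemeHom j) ∧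
        Hom.toSchemeHom g '' R = Set.range (Hom.toSchemeHom j) := by
    rintro R ⟨Z, j, hj, rfl⟩
    exact exists_subvariety_image_range g j
  have hgf' : ∀ R : Set X.X.left, (∃ (Z : Motives.AbelianVariety K) (j : Z ⟶ X),
      IsClosedImmersion (Hom.toSchemeHom j) ∧ R = Set.range (Hom.toSchemeHom j)) →
      Hom.toSchemeHom g '' (Hom.toSchemeHom f '' R) = R := by
    rintro R ⟨Z, j, hj, rfl⟩
    exact image_image_range_eq f hfg hN j
  have hfg' : ∀ R : Set X'.X.left, (∃ (Z : Motives.AbelianVariety K) (j : Z ⟶ X'),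
      IsClosedImmersion (Hom.toSchemeHom j) ∧ R = Set.range (Hom.toSchemeHom j)) →
      Hom.toSchemeHom f '' (Hom.toSchemeHom g '' R) = R := by
    rintro R ⟨Z, j, hj, rfl⟩
    exact image_image_range_eq g hgf hN j
  refine ⟨{ toFun := fun R ↦ ⟨Hom.toSchemeHom f '' (R : Set X.X.left), memf R R.2⟩
            invFun := fun R ↦ ⟨Hom.toSchemeHom g '' (R : Set X'.X.left), memg R R.2⟩
            left_inv := fun R ↦ Subtype.ext (hgf' R R.2)
            right_inv := fun R ↦ Subtype.ext (hfg' R R.2)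
            map_rel_iff' := ?_ }, fun R ↦ rfl⟩
  intro R S
  change Hom.toSchemeHom f '' (R : Set X.X.left) ⊆ Hom.toSchemeHom f '' (S : Set X.X.left) ↔ (R : Set X.X.left) ⊆ S
  refine ⟨fun h ↦ ?_, fun h ↦ Set.image_mono h⟩
  rw [← hgf' R R.2, ← hgf' S S.2]
  exact Set.image_mono h

/-- **`Z ↦ f(Z)` IS AN ORDER ISOMORPHISM BETWEEN THE `End X`-STABLE ABELIAN SUBVARIETIES OF `X` AND THE `End X'`-STABLE ONES OF `X'`**
(`f ≫ g = N • 𝟙`, `g ≫ f = N • 𝟙`, `N ≠ 0`; any field). [cite: SilverbergZarhin2015, Def. 2.2–2.3 (p. 3)] [cite: MumfordAV1970, §19 Remark p. 169]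
[cite: Zarhin2008HomomorphismsFiniteFields, Thm. 3.2 and §5 (pp. 7, 9)] -/
theorem exists_orderIso_stable_subvarieties_of_comp_eq_nsmul (hfg : f ≫ g = N • 𝟙 X) (hgf : g ≫ f = N • 𝟙 X') (hN : N ≠ 0) :
    ∃ Φ : {R : Set X.X.left | ∃ (Z : Motives.AbelianVariety K) (j : Z ⟶ X), IsClosedImmersion (Hom.toSchemeHom j) ∧
          R = Set.range (Hom.toSchemeHom j) ∧ ∀ φ : X ⟶ X, Set.range (Hom.toSchemeHom (j ≫ φ)) ⊆ Set.range (Hom.toSchemeHom j)} ≃o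
        {R : Set X'.X.left | ∃ (Z : Motives.AbelianVariety K) (j : Z ⟶ X'), IsClosedImmersion (Hom.toSchemeHom j) ∧
          R = Set.range (Hom.toSchemeHom j) ∧ ∀ φ : X' ⟶ X', Set.range (Hom.toSchemeHom (j ≫ φ)) ⊆ Set.range (Hom.toSchemeHom j)},
      ∀ R : {R : Set X.X.left | ∃ (Z : Motives.AbelianVariety K) (j : Z ⟶ X), IsClosedImmersion (Hom.toSchemeHom j) ∧
          R = Set.range (Hom.toSchemeHom j) ∧ ∀ φ : X ⟶ X, Set.range (Hom.toSchemeHom (j ≫ φ)) ⊆ Set.range (Hom.toSchemeHom j)},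
        ((Φ R : {R : Set X'.X.left | ∃ (Z : Motives.AbelianVariety K) (j : Z ⟶ X'), IsClosedImmersion (Hom.toSchemeHom j) ∧
          R = Set.range (Hom.toSchemeHom j) ∧ ∀ φ : X' ⟶ X', Set.range (Hom.toSchemeHom (j ≫ φ)) ⊆ Set.range (Hom.toSchemeHom j)}) :
            Set X'.X.left) = Hom.toSchemeHom f '' (R : Set X.X.left) := by
  have memf : ∀ R : Set X.X.left, (∃ (Z : Motives.AbelianVariety K) (j : Z ⟶ X), IsClosedImmersion (Hom.toSchemeHom j) ∧
      R = Set.range (Hom.toSchemeHom j) ∧ ∀ φ : X ⟶ X, Set.range (Hom.toSchemeHom (j ≫ φ)) ⊆ Set.range (Hom.toSchemeHom j)) →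
      ∃ (Z : Motives.AbelianVariety K) (j : Z ⟶ X'), IsClosedImmersion (Hom.toSchemeHom j) ∧
        Hom.toSchemeHom f '' R = Set.range (Hom.toSchemeHom j) ∧
          ∀ φ : X' ⟶ X', Set.range (Hom.toSchemeHom (j ≫ φ)) ⊆ Set.range (Hom.toSchemeHom j) := by
    rintro R ⟨Z, j, hj, rfl, hstab⟩
    refine ⟨_, imageι (j ≫ f), inferInstance, by rw [image_range_eq_range_comp, range_toSchemeHom_imageι], fun ψ ↦ ?_⟩
    rw [range_toSchemeHom_comp_eq_image, range_toSchemeHom_imageι, ← range_toSchemeHom_comp_eq_image]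
    exact forall_range_comp_subset_of_comp_eq_nsmul f hgf hN j hstab ψ
  have memg : ∀ R : Set X'.X.left, (∃ (Z : Motives.AbelianVariety K) (j : Z ⟶ X'), IsClosedImmersion (Hom.toSchemeHom j) ∧
      R = Set.range (Hom.toSchemeHom j) ∧ ∀ φ : X' ⟶ X', Set.range (Hom.toSchemeHom (j ≫ φ)) ⊆ Set.range (Hom.toSchemeHom j)) →
      ∃ (Z : Motives.AbelianVariety K) (j : Z ⟶ X), IsClosedImmersion (Hom.toSchemeHom j) ∧
        Hom.toSchemeHom g '' R = Set.range (Hom.toSchemeHom j) ∧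
          ∀ φ : X ⟶ X, Set.range (Hom.toSchemeHom (j ≫ φ)) ⊆ Set.range (Hom.toSchemeHom j) := by
    rintro R ⟨Z, j, hj, rfl, hstab⟩
    refine ⟨_, imageι (j ≫ g), inferInstance, by rw [image_range_eq_range_comp, range_toSchemeHom_imageι], fun ψ ↦ ?_⟩
    rw [range_toSchemeHom_comp_eq_image, range_toSchemeHom_imageι, ← range_toSchemeHom_comp_eq_image]
    exact forall_range_comp_subset_of_comp_eq_nsmul g hfg hN j hstab ψ
  have hgf' : ∀ R : Set X.X.left, (∃ (Z : Motives.AbelianVariety K) (j : Z ⟶ X), IsClosedImmersion (Hom.toSchemeHom j) ∧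
      R = Set.range (Hom.toSchemeHom j) ∧ ∀ φ : X ⟶ X, Set.range (Hom.toSchemeHom (j ≫ φ)) ⊆ Set.range (Hom.toSchemeHom j)) →
      Hom.toSchemeHom g '' (Hom.toSchemeHom f '' R) = R := by
    rintro R ⟨Z, j, hj, rfl, -⟩
    exact image_image_range_eq f hfg hN j
  have hfg' : ∀ R : Set X'.X.left, (∃ (Z : Motives.AbelianVariety K) (j : Z ⟶ X'), IsClosedImmersion (Hom.toSchemeHom j) ∧
      R = Set.range (Hom.toSchemeHom j) ∧ ∀ φ : X' ⟶ X', Set.range (Hom.toSchemeHom (j ≫ φ)) ⊆ Set.range (Hom.toSchemeHom j)) →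
      Hom.toSchemeHom f '' (Hom.toSchemeHom g '' R) = R := by
    rintro R ⟨Z, j, hj, rfl, -⟩
    exact image_image_range_eq g hgf hN j
  refine ⟨{ toFun := fun R ↦ ⟨Hom.toSchemeHom f '' (R : Set X.X.left), memf R R.2⟩
            invFun := fun R ↦ ⟨Hom.toSchemeHom g '' (R : Set X'.X.left), memg R R.2⟩
            left_inv := fun R ↦ Subtype.ext (hgf' R R.2)
            right_inv := fun R ↦ Subtype.ext (hfg' R R.2)
            map_rel_iff' := ?_ }, fun R ↦ rfl⟩
  intro R S
  change Hom.toSchemeHom f '' (R : Set X.X.left) ⊆ Hom.toSchemeHom f '' (S : Set X.X.left) ↔ (R : Set X.X.left) ⊆ S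
  refine ⟨fun h ↦ ?_, fun h ↦ Set.image_mono h⟩
  rw [← hgf' R R.2, ← hgf' S S.2]
  exact Set.image_mono h

end OrderIso

/-! ## §3 Isogenous abelian varieties (any field) -/

section Isogenous

variable {X X' : Motives.AbelianVariety K}

/-- **ISOGENOUS ABELIAN VARIETIES HAVE ORDER-ISOMORPHIC LATTICES OF ABELIAN SUBVARIETIES** (any field).
[cite: MumfordAV1970, §19 Thm. 1 (p. 173) and Remark p. 169] [cite: Zarhin2008HomomorphismsFiniteFields, Thm. 3.2 (p. 7)] -/
theorem nonempty_orderIso_subvarieties_of_isIsogenous (h : IsIsogenous X X') :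
    Nonempty ({R : Set X.X.left | ∃ (Z : Motives.AbelianVariety K) (j : Z ⟶ X),
          IsClosedImmersion (Hom.toSchemeHom j) ∧ R = Set.range (Hom.toSchemeHom j)} ≃o
        {R : Set X'.X.left | ∃ (Z : Motives.AbelianVariety K) (j : Z ⟶ X'),
          IsClosedImmersion (Hom.toSchemeHom j) ∧ R = Set.range (Hom.toSchemeHom j)}) := by
  obtain ⟨f, hf⟩ := h
  obtain ⟨g, N, hN, hfg, hgf⟩ := IsIsogeny.exists_nsmul_inverse_holds hf
  obtain ⟨Φ, -⟩ := exists_orderIso_subvarieties_of_comp_eq_nsmul f hfg hgf hN.ne'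
  exact ⟨Φ⟩

/-- Finiteness of the set of `End`-stable abelian subvarieties is an isogeny invariant (any field).
[cite: Zarhin2008HomomorphismsFiniteFields, Thm. 3.2 and §5 (pp. 7, 9)] -/
theorem finite_setOf_range_stable_subvariety_iff_of_isIsogenous (h : IsIsogenous X X') :
    {R : Set X.X.left | ∃ (Z : Motives.AbelianVariety K) (j : Z ⟶ X), IsClosedImmersion (Hom.toSchemeHom j) ∧
        R = Set.range (Hom.toSchemeHom j) ∧ ∀ φ : X ⟶ X, Set.range (Hom.toSchemeHom (j ≫ φ)) ⊆ Set.range (Hom.toSchemeHom j)}.Finite ↔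
      {R : Set X'.X.left | ∃ (Z : Motives.AbelianVariety K) (j : Z ⟶ X'), IsClosedImmersion (Hom.toSchemeHom j) ∧
        R = Set.range (Hom.toSchemeHom j) ∧ ∀ φ : X' ⟶ X', Set.range (Hom.toSchemeHom (j ≫ φ)) ⊆ Set.range (Hom.toSchemeHom j)}.Finite := by
  obtain ⟨f, hf⟩ := h
  obtain ⟨g, N, hN, hfg, hgf⟩ := IsIsogeny.exists_nsmul_inverse_holds hf
  obtain ⟨Φ, -⟩ := exists_orderIso_stable_subvarieties_of_comp_eq_nsmul f hfg hgf hN.ne'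
  rw [← Set.finite_coe_iff, ← Set.finite_coe_iff]
  exact ⟨fun _ ↦ Finite.of_equiv _ Φ.toEquiv, fun _ ↦ Finite.of_equiv _ Φ.toEquiv.symm⟩

end Isogenous

end AbelianVariety

end Literature.AlgebraicGeometry.HodgeTheory

end
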